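import Summits.Schanuel.Schanuel.Theses.RoyCriterion
import Literature.NumberTheory.Transcendental.PhilipponZeroEstimateHolds

/-!
# Crux-ideate sketch — crux `stmt-Schanuel-0463` (`RoyCriterion.RoyThesisTyped = ∀ n, RoyCriterion n`)
ideator 2 (planner-cruxidea-stmt-Schanuel-0463-2-0), round 1, 2026-08-16.

Card `liouville-saturation-ze-edge`: first lemmas (Props, to be proved at crux-plan stage) and the
kernel-checked TRANSFER `sharpened_implies_crux : (∀ l, SharpenedCriterion l) → RoyThesisTyped`.
Nothing here is asserted with `sorry`; the open content is carried by `Prop`-valued definitions.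
-/

noncomputable section

open MvPolynomial Filter Complex
open Literature.NumberTheory.Transcendental

namespace Summit.Schanuel.Schanuel.Cruxes.RoyThesisTyped.Ideate2

/-! ### 1. Liouville saturation: at an algebraic point the box values vanish EXACTLY -/

/-- **Liouville saturation** (first lemma, provable now from the tree's number-field Liouville
inequality `Roy2013.one_le_mulHeight_pow_mul_prod`): if every coordinate of `(y, α)` is algebraic
and `u` lies above the Liouville edges `max{1, s₀, t₀, s₁+t₁} < u`, then Roy's small-value
hypothesis forces, for every large `N`, a non-zero `P_N` of the prescribed partial degrees whose
box values `D^k P_N(∑ mⱼyⱼ, ∏ αⱼ^{mⱼ})` are all `0` (not merely `≤ e^{-N^u}`).  Reason: such a value is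
an element of the number field `ℚ(y, α)` of logarithmic size `≪ N + N^{s₀} log N + N^{t₀} log N +
N^{s₁+t₁}`, so by Liouville it is `0` or `≥ exp(-[K:ℚ]·(that))`, which beats `exp(-N^u)`. -/
def LiouvilleSaturation : Prop :=
  ∀ (l : ℕ) (y α : Fin l → ℂ), (∀ j, IsAlgebraic ℚ (y j)) → (∀ j, IsAlgebraic ℚ (α j)) →
    (∀ j, α j ≠ 0) →
    ∀ (s₀ s₁ t₀ t₁ u : ℝ), 0 < s₀ → 0 < s₁ → 0 < t₀ → 0 < t₁ →
      max 1 (max s₀ (max t₀ (s₁ + t₁))) < u →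
      RoyHypothesis y α s₀ s₁ t₀ t₁ u →
      ∀ᶠ N : ℕ in atTop, ∃ P : MvPolynomial (Fin 2) ℤ, P ≠ 0 ∧
        (P.degreeOf 0 : ℝ) ≤ (N : ℝ) ^ t₀ ∧ (P.degreeOf 1 : ℝ) ≤ (N : ℝ) ^ t₁ ∧
        ∀ (k : ℕ) (m : Fin l → ℕ), (k : ℝ) ≤ (N : ℝ) ^ s₀ → (∀ j, (m j : ℝ) ≤ (N : ℝ) ^ s₁) →
          aeval ![∑ j, (m j : ℂ) * y j, ∏ j, α j ^ m j] (royD^[k] P) = 0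

/-! ### 2. The oversaturated box zero estimate (from `Philippon1986_GaGm_holds`, `m = 1`) -/

/-- **Oversaturated-box zero estimate** (first lemma bis, provable now from the tree's
`Philippon1986_GaGm_holds` with `m = 1`, `W = ℂ·(1,1)` (the direction of Roy's `D = ∂₀ + X₁∂₁`),
`Σ = {(∑ mⱼyⱼ, ∏ αⱼ^{mⱼ}) : 0 ≤ mⱼ ≤ N^{s₁}/2} ∋ e`, `T = ⌊N^{s₀}/2⌋`): above the ZERO-ESTIMATE EDGE
`t₀ + t₁ < s₀ + l·s₁` and `t₁ < s₀` no non-zero `P` of partial degrees `≤ (N^{t₀}, N^{t₁})` can have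
all its box values equal to `0`.  The three proper connected algebraic subgroups `{e}`, `𝔾ₐ × 1`,
`0 × 𝔾ₘ` of `𝔾ₐ × 𝔾ₘ` are transversal to `(1,1)` (so Philippon's exponent `s = 1`) and give the
facets `s₀ + l s₁ > t₀ + t₁`, `s₀ > t₁` (this one survives even when every `αⱼ` is torsion: then
`card((Σ·𝔾ₐ)/𝔾ₐ)` may be `1`), `s₀ + l s₁ > t₀`; linear independence of `y` gives
`card Σ = (M+1)^l`. -/
def OversaturatedBoxZE : Prop :=
  ∀ (l : ℕ) (y α : Fin l → ℂ), LinearIndependent ℚ y → (∀ j, α j ≠ 0) →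
    ∀ (s₀ s₁ t₀ t₁ : ℝ), 0 < s₀ → 0 < s₁ → 0 < t₀ → 0 < t₁ →
      t₀ + t₁ < s₀ + l * s₁ → t₁ < s₀ →
      ∀ᶠ N : ℕ in atTop, ∀ P : MvPolynomial (Fin 2) ℤ,
        (P.degreeOf 0 : ℝ) ≤ (N : ℝ) ^ t₀ → (P.degreeOf 1 : ℝ) ≤ (N : ℝ) ^ t₁ →
        (∀ (k : ℕ) (m : Fin l → ℕ), (k : ℝ) ≤ (N : ℝ) ^ s₀ → (∀ j, (m j : ℝ) ≤ (N : ℝ) ^ s₁) →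
          aeval ![∑ j, (m j : ℂ) * y j, ∏ j, α j ^ m j] (royD^[k] P) = 0) →
        P = 0

/-! ### 3. The stratum theorem: Roy's hypothesis is self-refuting at algebraic points -/

/-- **X on the `ℚ̄`-stratum, all ranks** (the card's target; `LiouvilleSaturation →
OversaturatedBoxZE → this` is two lines of filter bookkeeping): for `l ≥ 1`, `y` linearly
independent over `ℚ`, `αⱼ ≠ 0`, all `yⱼ, αⱼ` algebraic and ANY admissible parameters, Roy's
hypothesis fails.  (On the exponential locus this stratum is empty by Hermite–Lindemann; the point
is that it is proved here by Roy's mechanism alone — small values ⇒ exact zeros ⇒ zero estimate —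
with no transcendence input, and uniformly in the rank.) -/
def RoyHypothesisFailsAtAlgebraicPoints : Prop :=
  ∀ (l : ℕ) (y α : Fin l → ℂ), 1 ≤ l → LinearIndependent ℚ y → (∀ j, α j ≠ 0) →
    (∀ j, IsAlgebraic ℚ (y j)) → (∀ j, IsAlgebraic ℚ (α j)) →
    ∀ (s₀ s₁ t₀ t₁ u : ℝ), RoyAdmissible s₀ s₁ t₀ t₁ u → ¬ RoyHypothesis y α s₀ s₁ t₀ t₁ u

/-- The direct route to the route's rank-one support item (`RoyCriterion.RoyCriterionRankOne`,
stmt-Schanuel-0465) WITHOUT Hermite–Lindemann and without Roy's Theorem 1: if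
`trdeg ℚ(y₀, α₀) < 1` both numbers are algebraic and the stratum theorem refutes the hypothesis.
Stated as an implication to be proved at plan stage (needs `trdeg = 0 ↔ algebraic` for a finitely
generated `IntermediateField.adjoin`, Mathlib `Algebra.trdeg_eq_zero_iff` /
`IntermediateField.isAlgebraic_adjoin`). -/
def RankOneDirect : Prop :=
  RoyHypothesisFailsAtAlgebraicPoints → RoyCriterion 1

/-! ### 4. TRANSFER: the window-free criterion X♯ down to the zero-estimate edge -/

/-- The region where X♯ is asserted: the zero-estimate facets `t₀ + t₁ < s₀' + l·s₁'`, `t₁ < s₀'`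
(below them EXACT integer solutions exist at every algebraic point by Siegel's lemma, so nothing
can hold), the Liouville/integer-Dirichlet facet `max{1, s₀', t₀, s₁'+t₁} < u` (below it Dirichlet's
box principle produces the polynomials at EVERY point), and constructibility `u < (1+t₀+t₁)/2`
(above it Waldschmidt's construction no longer supplies the hypothesis on the exponential locus, so
the statement would be vacuous there). Roy's window (1) lies strictly inside
(`zeEdge_of_royAdmissible`). -/
def ZEEdge (l : ℕ) (s₀' s₁' t₀ t₁ u : ℝ) : Prop :=
  0 < s₀' ∧ 0 < s₁' ∧ 0 < t₀ ∧ 0 < t₁ ∧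
    t₀ + t₁ < s₀' + l * s₁' ∧ t₁ < s₀' ∧
    max 1 (max s₀' (max t₀ (s₁' + t₁))) < u ∧ u < (1 + t₀ + t₁) / 2

/-- **X♯(l), the sharpened (window-free) criterion**: Roy's Conjecture 2 with the multiplicity
range `k ≤ N^{s₀'}` and translation range `mⱼ ≤ N^{s₁'}` decoupled from the interpolation window and
lowered to the zero-estimate edge.  `RoyHypothesis` is used verbatim with the primed exponents. -/
def SharpenedCriterion (l : ℕ) : Prop :=
  ∀ (y α : Fin l → ℂ), LinearIndependent ℚ y → (∀ j, α j ≠ 0) →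
    ∀ (s₀' s₁' t₀ t₁ u : ℝ), ZEEdge l s₀' s₁' t₀ t₁ u → RoyHypothesis y α s₀' s₁' t₀ t₁ u →
      (l : Cardinal) ≤ Algebra.trdeg ℚ
        ↥(IntermediateField.adjoin ℚ (Set.range y ∪ Set.range α))

/-- Roy's admissible window (1) lies inside the X♯-region for every rank `l ≥ 1`. -/
theorem zeEdge_of_royAdmissible {l : ℕ} (hl : 1 ≤ l) {s₀ s₁ t₀ t₁ u : ℝ}
    (h : RoyAdmissible s₀ s₁ t₀ t₁ u) : ZEEdge l s₀ s₁ t₀ t₁ u := by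
  rcases h with ⟨hs₀, hs₁, ht₀, ht₁, _hu, hmax, hsu, hu2⟩
  have h1 : max 1 (max t₀ (2 * t₁)) < s₀ := lt_of_lt_of_le hmax (min_le_left _ _)
  have h2 : max 1 (max t₀ (2 * t₁)) < 2 * s₁ := lt_of_lt_of_le hmax (min_le_right _ _)
  have h1s₀ : 1 < s₀ := lt_of_le_of_lt (le_max_left _ _) h1
  have ht₀s₀ : t₀ < s₀ := lt_of_le_of_lt ((le_max_left _ _).trans (le_max_right _ _)) h1
  have ht₁s₀ : 2 * t₁ < s₀ := lt_of_le_of_lt ((le_max_right _ _).trans (le_max_right _ _)) h1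
  have ht₁s₁ : 2 * t₁ < 2 * s₁ := lt_of_le_of_lt ((le_max_right _ _).trans (le_max_right _ _)) h2
  have hs₀u : s₀ < u := lt_of_le_of_lt (le_max_left _ _) hsu
  have hstu : s₁ + t₁ < u := lt_of_le_of_lt (le_max_right _ _) hsu
  have hl' : (1 : ℝ) ≤ (l : ℝ) := by exact_mod_cast hl
  have hls₁ : s₁ ≤ (l : ℝ) * s₁ := le_mul_of_one_le_left hs₁.le hl'
  refine ⟨hs₀, hs₁, ht₀, ht₁, by linarith, by linarith, ?_, hu2⟩
  refine max_lt (by linarith) (max_lt hs₀u (max_lt (by linarith) hstu))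

/-- **Transfer, rank by rank**: X♯(l) implies Roy's Conjecture 2 for rank `l`. -/
theorem sharpened_implies_royCriterion {l : ℕ} (h : SharpenedCriterion l) : RoyCriterion l := by
  intro y α hy hα s₀ s₁ t₀ t₁ u hadm hhyp
  rcases Nat.eq_zero_or_pos l with hl0 | hl
  · subst hl0
    simp
  · exact h y α hy hα s₀ s₁ t₀ t₁ u (zeEdge_of_royAdmissible hl hadm) hhyp

/-- **Transfer to the crux BY NAME**: `(∀ l, X♯(l)) → RoyThesisTyped`. -/
theorem sharpened_implies_crux (h : ∀ l, SharpenedCriterion l) :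
    Summit.Schanuel.Schanuel.Theses.RoyCriterion.RoyThesisTyped :=
  fun n => sharpened_implies_royCriterion (h n)

/-- The `ℚ̄`-stratum of X♯ is decided by the same two first lemmas (statement; proof = saturation
+ zero estimate, both of which are stated on the whole ZE region, not only on the window). -/
def SharpenedAtAlgebraicPoints : Prop :=
  ∀ (l : ℕ) (y α : Fin l → ℂ), 1 ≤ l → LinearIndependent ℚ y → (∀ j, α j ≠ 0) →
    (∀ j, IsAlgebraic ℚ (y j)) → (∀ j, IsAlgebraic ℚ (α j)) →
    ∀ (s₀' s₁' t₀ t₁ u : ℝ), ZEEdge l s₀' s₁' t₀ t₁ u → ¬ RoyHypothesis y α s₀' s₁' t₀ t₁ u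

/-- Bookkeeping check that the two first lemmas compose to the stratum statement on the whole
ZE region (hence, via `zeEdge_of_royAdmissible`, to `RoyHypothesisFailsAtAlgebraicPoints`). -/
theorem sharpenedAtAlgebraicPoints_of (hL : LiouvilleSaturation) (hZ : OversaturatedBoxZE) :
    SharpenedAtAlgebraicPoints := by
  intro l y α _hl hy hα hyalg hαalg s₀ s₁ t₀ t₁ u hedge hhyp
  rcases hedge with ⟨hs₀, hs₁, ht₀, ht₁, hze, ht₁s₀, hu, _hu2⟩
  have hL' := hL l y α hyalg hαalg hα s₀ s₁ t₀ t₁ u hs₀ hs₁ ht₀ ht₁ hu hhyp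
  have hZ' := hZ l y α hy hα s₀ s₁ t₀ t₁ hs₀ hs₁ ht₀ ht₁ hze ht₁s₀
  obtain ⟨N, hN⟩ := (hL'.and hZ').exists
  obtain ⟨⟨P, hP0, hd0, hd1, hvan⟩, hzero⟩ := hN
  exact hP0 (hzero P hd0 hd1 hvan)

theorem royHypothesisFailsAtAlgebraicPoints_of (hL : LiouvilleSaturation)
    (hZ : OversaturatedBoxZE) : RoyHypothesisFailsAtAlgebraicPoints :=
  fun l y α hl hy hα hyalg hαalg s₀ s₁ t₀ t₁ u hadm =>
    sharpenedAtAlgebraicPoints_of hL hZ l y α hl hy hα hyalg hαalg s₀ s₁ t₀ t₁ u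
      (zeEdge_of_royAdmissible hl hadm)

/-! ### 5. Pointer to the tree's zero estimate used by `OversaturatedBoxZE` -/

/-- The named fact the box zero estimate rests on (PROVED in tree:
`Literature.NumberTheory.Transcendental.Philippon1986_GaGm_holds`). -/
example : Philippon1986_GaGm := Philippon1986_GaGm_holds

end Summit.Schanuel.Schanuel.Cruxes.RoyThesisTyped.Ideate2

end
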